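import Literature.Analysis.Complex.LaplaceHalfLineFourier
import Literature.Analysis.Convolution.RenewalResolventSymbol
import HarnessLib

/-!
# The resolvent of a CONTINUOUS exponentially decaying renewal kernel, I: symbol, transformed equation, and line integrability of `Φ = (𝓛k)²/E`
# from Riemann–Lebesgue + Plancherel (no differentiability of the kernel)

Topic `Literature/Analysis/Convolution`; the continuous-kernel twin of `RenewalResolventSymbol.lean`. Everything PROVED. The hypothesis structure
`RenewalKernelData k r E K μ R a₀ β β₀` is `RenewalPoleData` WITHOUT the `C¹` fields (`k′`, `HasDerivAt`): `k` is merely continuous with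
`‖k(t)‖ ≤ Ke^{−μt}` on `t ≥ 0`. The price of dropping one integration by parts is paid by two classical facts about the half-line Laplace transform on a
vertical line `Re σ = u > −μ` (`LaplaceHalfLineFourier.lean`): RIEMANN–LEBESGUE (`‖𝓛k(u+iy)‖ ≤ ½` for `|y|` large, so `|E| ≥ ½` there) and PLANCHEREL
(`y ↦ ‖𝓛k(u+iy)‖²` integrable), which together give the integrability of `Φ(u + iy) = (𝓛k)²/E` on every line on which `E ≠ 0`
(`integrable_sq_div_vertical`). Steps 1 and 3 are otherwise as in the `C¹` file (same statements, same proofs); Step 2 (the `O(1/|σ|²)` strip bound) is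
replaced in Part II by the UNIFORM Riemann–Lebesgue lemma of `LaplaceHalfLineUniformRL.lean`. Source of the theorem: Gripenberg–Londen–Staffans 1990, Ch. 7
Thm 2.1 (continuous/`L¹` kernels; citation = provenance only). NOT here: Part II (the contour shift), operators, any model.
-/

noncomputable section

open _root_.Complex _root_.MeasureTheory _root_.Set _root_.Filter _root_.Real
open scoped _root_.Topology
open Literature.Analysis.Complex

namespace Literature.Analysis.Convolution

/-- **Hypotheses of the continuous-kernel resolvent pole theorem.** `k` is continuous on `[0,∞)` with `‖k‖ ≤ K e^{−μt}`; `r` is continuous of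
exponential order `a₀` and solves `r = k + k ⋆ r` on `[0,∞)`; `E` agrees with the symbol `1 − 𝓛k` on `Re σ > −μ`, does not vanish on
`{Re σ > −β₀} ∖ {1}`, and has a simple zero at `σ = 1`; `0 < β < β₀ ≤ μ`. [cite: GripenbergLondenStaffans1990, Ch. 7 Thm 2.1 (hypotheses, one simple zero)] -/
structure RenewalKernelData (k r : ℝ → ℂ) (E : ℂ → ℂ) (K μ R a₀ β β₀ : ℝ) : Prop where
  hk : HalfLineExpBound k K (-μ)
  hμ : 0 < μ
  hr : HalfLineExpBound r R a₀
  resolvent_eq : ∀ t : ℝ, 0 ≤ t → r t = k t + ∫ u in (0 : ℝ)..t, k (t - u) * r u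
  hE : ∀ s : ℂ, -μ < s.re → E s = 1 - laplaceC k s
  hβ : 0 < β
  hββ₀ : β < β₀
  hβ₀μ : β₀ ≤ μ
  ne_zero : ∀ s : ℂ, -β₀ < s.re → s ≠ 1 → E s ≠ 0
  E_one : E 1 = 0
  deriv_ne_zero : deriv E 1 ≠ 0

/-- The `C¹` hypothesis structure `RenewalPoleData` forgets to the continuous one. [cite: GripenbergLondenStaffans1990, Ch. 7 Thm 2.1] -/
theorem RenewalPoleData.toKernelData {k k' r : ℝ → ℂ} {E : ℂ → ℂ} {K μ R a₀ β β₀ : ℝ}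
    (h : RenewalPoleData k k' r E K μ R a₀ β β₀) : RenewalKernelData k r E K μ R a₀ β β₀ :=
  ⟨h.hk, h.hμ, h.hr, h.resolvent_eq, h.hE, h.hβ, h.hββ₀, h.hβ₀μ, h.ne_zero, h.E_one, h.deriv_ne_zero⟩

namespace RenewalKernelData

variable {k r : ℝ → ℂ} {E : ℂ → ℂ} {K μ R a₀ β β₀ : ℝ}

/-! ### Step 1: the transformed resolvent equation -/

/-- `𝓛k(1) = 1` (the zero of the symbol). [cite: GripenbergLondenStaffans1990, Ch. 7 Thm 2.1 (proof)] -/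
theorem laplaceC_k_one (h : RenewalKernelData k r E K μ R a₀ β β₀) : laplaceC k 1 = 1 := by
  have h1 := h.hE 1 (by simp; linarith [h.hμ])
  rw [h.E_one] at h1
  linear_combination h1

/-- The resolvent equation transformed: `𝓛r(σ)·E(σ) = 𝓛k(σ)` on `Re σ > max(−μ, a₀)` (Convolution Theorem).
[cite: Schiff1999, Theorem 2.39 / (2.43)] -/
theorem laplaceC_r_mul_E (h : RenewalKernelData k r E K μ R a₀ β β₀) {s : ℂ} (hs : -μ < s.re) (hs' : a₀ < s.re) :
    laplaceC r s * E s = laplaceC k s := by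
  -- common exponential order `γ = max (−μ) a₀`
  set γ : ℝ := max (-μ) a₀ with hγ
  have hγs : γ < s.re := max_lt hs hs'
  have hkγ : HalfLineExpBound k K γ := h.hk.mono (le_max_left _ _)
  have hrγ : HalfLineExpBound r R γ := h.hr.mono (le_max_right _ _)
  have hconv := hkγ.laplaceC_conv hrγ hγs
  have hik := h.hk.integrableOn hs
  have hir := h.hr.integrableOn hs'
  -- the convolution integrand is integrable, being `r − k` on `(0,∞)`
  have hic : IntegrableOn (fun t : ℝ => cexp (-(s * t)) * ∫ u in (0 : ℝ)..t, k (t - u) * r u) (Ioi 0) := by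
    refine (hir.sub hik).congr_fun (fun t ht => ?_) measurableSet_Ioi
    simp only [Pi.sub_apply]
    rw [h.resolvent_eq t (le_of_lt ht)]
    ring
  have hsum : laplaceC r s = laplaceC k s + laplaceC k s * laplaceC r s := by
    rw [← hconv, ← laplaceC_add hik hic]
    exact laplaceC_congr (fun t ht => h.resolvent_eq t (le_of_lt ht)) s
  rw [h.hE s hs]
  linear_combination hsum

/-- `𝓛(r − k) = (𝓛k)²/E` wherever `E ≠ 0` on `Re σ > max(−μ, a₀)`. [cite: GripenbergLondenStaffans1990, Ch. 7 Thm 2.1 (proof)] -/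
theorem laplaceC_sub_eq (h : RenewalKernelData k r E K μ R a₀ β β₀) {s : ℂ} (hs : -μ < s.re) (hs' : a₀ < s.re)
    (hE0 : E s ≠ 0) : laplaceC (fun t => r t - k t) s = (laplaceC k s) ^ 2 / E s := by
  have h1 := h.laplaceC_r_mul_E hs hs'
  have h2 := h.hE s hs
  rw [laplaceC_sub (h.hr.integrableOn hs') (h.hk.integrableOn hs), eq_div_iff hE0]
  linear_combination h1 - laplaceC k s * h2

/-! ### Step 2: `|E| ≥ 1/2` wherever `|𝓛k| ≤ 1/2` -/

/-- `‖E(σ)‖ ≥ 1/2` wherever `‖𝓛k(σ)‖ ≤ 1/2` (`Re σ > −μ`). [cite: GripenbergLondenStaffans1990, Ch. 7 Thm 2.1 (proof)] -/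
theorem half_le_norm_E (h : RenewalKernelData k r E K μ R a₀ β β₀) {s : ℂ} (hs : -μ < s.re)
    (hsmall : ‖laplaceC k s‖ ≤ 1 / 2) : 1 / 2 ≤ ‖E s‖ := by
  rw [h.hE s hs]
  have := norm_sub_norm_le (1 : ℂ) (laplaceC k s)
  rw [norm_one] at this
  linarith [abs_sub_abs_le_abs_sub ‖(1 : ℂ)‖ ‖laplaceC k s‖]

/-! ### Step 3: holomorphy, continuity and integrability of `Φ` on the lines -/

/-- `E` is holomorphic on `Re σ > −μ`. [cite: Schiff1999, Theorem 3.1] -/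
theorem differentiableOn_E (h : RenewalKernelData k r E K μ R a₀ β β₀) :
    DifferentiableOn ℂ E {s : ℂ | -μ < s.re} :=
  ((differentiableOn_const (1 : ℂ)).sub h.hk.differentiableOn_laplaceC).congr fun s hs => h.hE s hs

/-- `Φ = (𝓛k)²/E` is holomorphic on `{Re σ > −β₀} ∖ {1}`. [cite: GripenbergLondenStaffans1990, Ch. 7 Thm 2.1 (proof)] -/
theorem differentiableOn_sq_div (h : RenewalKernelData k r E K μ R a₀ β β₀) :
    DifferentiableOn ℂ (fun s => (laplaceC k s) ^ 2 / E s) ({s : ℂ | -β₀ < s.re} \ ({1} : Finset ℂ)) := by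
  have hsub : {s : ℂ | -β₀ < s.re} \ (({1} : Finset ℂ) : Set ℂ) ⊆ {s : ℂ | -μ < s.re} := fun s hs => by
    have : -β₀ < s.re := hs.1
    show -μ < s.re
    linarith [h.hβ₀μ]
  refine ((h.hk.differentiableOn_laplaceC.mono hsub).pow 2).div (h.differentiableOn_E.mono hsub) fun s hs => ?_
  exact h.ne_zero s hs.1 (by simpa using hs.2)

/-- Along a vertical line `Re σ = u` with `u > −μ` on which `E ≠ 0`, `y ↦ Φ(u + iy)` is continuous.
[cite: Schiff1999, Theorem 3.1] -/
theorem continuous_sq_div_vertical (h : RenewalKernelData k r E K μ R a₀ β β₀) {u : ℝ} (hu : -μ < u)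
    (hE0 : ∀ y : ℝ, E (u + y * I) ≠ 0) :
    Continuous fun y : ℝ => (laplaceC k (u + y * I)) ^ 2 / E (u + y * I) := by
  have hc := h.hk.continuous_laplaceC_vertical hu
  have hE : Continuous fun y : ℝ => E (u + y * I) := by
    have : (fun y : ℝ => E (u + y * I)) = fun y : ℝ => 1 - laplaceC k (u + y * I) := by
      ext y; exact h.hE _ (by simpa using hu)
    rw [this]; exact continuous_const.sub hc
  exact (hc.pow 2).div hE hE0

/-- **Integrability of `Φ` along a line `Re σ = u`, `u > −μ`, on which `E ≠ 0`** — from Riemann–Lebesgue (`‖𝓛k‖ ≤ ½` eventually, so `‖E‖ ≥ ½`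
there), a compactness bound for `1/‖E‖` on the bounded part, and Plancherel (`‖𝓛k(u+iy)‖²` integrable). [cite: Schiff1999, §4.1–4.2 / Theorem 1.11] -/
theorem integrable_sq_div_vertical (h : RenewalKernelData k r E K μ R a₀ β β₀) {u : ℝ} (hu : -μ < u)
    (hE0 : ∀ y : ℝ, E (u + y * I) ≠ 0) :
    Integrable fun y : ℝ => (laplaceC k (u + y * I)) ^ 2 / E (u + y * I) := by
  have hcont := h.continuous_sq_div_vertical hu hE0
  -- Riemann–Lebesgue: `‖𝓛k‖ ≤ 1/2` beyond `Y₀`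
  obtain ⟨Y₀, hY₀, hsmall⟩ := exists_norm_laplaceC_vertical_le k u (show (0 : ℝ) < 1 / 2 by norm_num)
  -- a bound for `1/‖E‖` on `[-Y₀, Y₀]`
  have hEc : Continuous fun y : ℝ => E (u + y * I) := by
    have : (fun y : ℝ => E (u + y * I)) = fun y : ℝ => 1 - laplaceC k (u + y * I) := by
      ext y; exact h.hE _ (by simpa using hu)
    rw [this]; exact continuous_const.sub (h.hk.continuous_laplaceC_vertical hu)
  have hinvc : ContinuousOn (fun y : ℝ => (E (u + y * I))⁻¹) (Icc (-Y₀) Y₀) :=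
    (hEc.continuousOn).inv₀ fun y _ => hE0 y
  obtain ⟨B, hB⟩ := (isCompact_Icc (a := -Y₀) (b := Y₀)).exists_bound_of_continuousOn hinvc
  have hB0 : 0 ≤ B := (norm_nonneg _).trans (hB 0 ⟨by linarith, by linarith⟩)
  -- domination by `max 2 B · ‖𝓛k‖²`
  have hsq := h.hk.integrable_norm_sq_laplaceC_vertical hu
  refine Integrable.mono' (hsq.const_mul (max 2 B)) hcont.aestronglyMeasurable (Eventually.of_forall fun y => ?_)
  rw [norm_div, norm_pow, div_eq_mul_inv, mul_comm]
  refine mul_le_mul_of_nonneg_right ?_ (sq_nonneg _)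
  by_cases hy : |y| ≤ Y₀
  · have hyI : y ∈ Icc (-Y₀) Y₀ := ⟨by linarith [neg_abs_le y], le_trans (le_abs_self y) hy⟩
    have := hB y hyI
    rw [norm_inv] at this
    exact this.trans (le_max_right _ _)
  · have hs := hsmall y (le_of_lt (not_le.1 hy))
    have hE := h.half_le_norm_E (s := u + y * I) (by simpa using hu) hs
    have hEpos : 0 < ‖E (u + y * I)‖ := by linarith
    calc ‖E (↑u + ↑y * I)‖⁻¹ ≤ (1 / 2)⁻¹ := by rw [inv_le_inv₀ hEpos (by norm_num)]; exact hE
      _ = 2 := by norm_num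
      _ ≤ max 2 B := le_max_left _ _

end RenewalKernelData

end Literature.Analysis.Convolution
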